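import Summits.QuantumFields.YangMills.Theorems.NPointIsotropy.Negative.PlanarGenericJunk

/-!
# Negative results on `PencilRigidity.NPointIsotropy`, X: the junk family is not `NPointRegular`

Drefute seat (refuter, line `complex-rotation-bandlimit`, crux stmt-QuantumFields-11686). The generation-2 skeletons of
the lines `complex-rotation-bandlimit` and `quarter-turn-corner-operator` carry, as the output of their ONLY lattice stub
(`stub_tieRegularity`) and as the hypothesis that protects their model-blind composition from the junk family, the `L¹`
("function") residual

  `NPointRegular S₁ : ∀ n, ∃ Wₙ, ∀ F ∈ ⁰𝒮ₙ, Wₙ·F ∈ L¹ ∧ 𝔖ₙ(F) = ∫ Wₙ·F`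

— weaker than the continuity residual of the disprover's `NPointIsotropyRegularModelBlind` (`Disproof.lean` §7b). The
skeletons assert in prose that junk is still excluded ("`J` charges a Lebesgue-null set"). This file certifies it:

* `volume_eqTime_zero`, `volume_planarDegenerateSet` — the planar-degenerate configurations (two points with the same
  `(x₀,x₁)`-projection) form a Lebesgue-null closed set (inside finitely many proper hyperplanes `{z_p⁰ = z_q⁰}`);
* `not_nPointRegular_junk` — `junk` (files II–V: every typed OS clause in all sixteen frames, translations, hypercubic
  symmetry, gap, `K = 0`) is NOT `NPointRegular`: a representing `W₄` would vanish a.e. on the open co-null complement of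
  the planar-degenerate set (file VIII `J_eq_zero_of_planar_generic` + du Bois-Reymond), hence a.e., contradicting
  `J F₀ ≠ 0` (file IV).

So the `L¹` weakening of the Step-0 residual costs the lines nothing against the known junk; equivalently, any refutation
of their composition `regularModelBlind_of_stubs` needs a family whose `𝔖₄|⁰𝒮` is an honest `L¹_loc` function.
-/

noncomputable section

-- Mathlib's `SimplexCategory` instance `Fintype (Fin (x.len + 1))` matches `Fintype (Fin 4)` (tree-known workaround,
-- files I–IX).
attribute [-instance] SimplexCategory.instFintypeToTypeOrderHomFinHAddNatLenOfNat

namespace Summit.QuantumFields.YangMills.Theorems.NPointIsotropy.Negative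

open scoped BigOperators SchwartzMap
open MeasureTheory Filter Topology
open Literature.MathematicalPhysics.QuantumLattice Literature.MathematicalPhysics.AQFT

/-- **`n`-point regularity** (VERBATIM the Step-0 residual `NPointRegular` of the gen-2 line skeletons
`Cruxes/NPointIsotropy/Lines/complex-rotation-bandlimit.lean` and `…/quarter-turn-corner-operator.lean`): every
`𝔖ₙ|⁰𝒮` is integration against a function. -/
def NPointRegular (S₁ : SchwingerFamily E4) : Prop :=
  ∀ n : ℕ, ∃ W : (Fin n → E4) → ℂ, ∀ F : 𝓢((Fin n → E4), ℂ), IsOffDiagonal F →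
    MeasureTheory.Integrable (fun x : Fin n → E4 => W x * F x) ∧ S₁ n F = ∫ x : Fin n → E4, W x * F x

/-! ### The planar-degenerate set is closed and null -/

/-- The set of planar-degenerate four-point configurations (file VIII's `IsPlanarDegenerate`). -/
def planarDegenerateSet : Set (Fin 4 → E4) := {z | IsPlanarDegenerate z}

/-- The planar-degenerate set as a finite union of codimension-two linear pieces. -/
theorem planarDegenerateSet_eq :
    planarDegenerateSet = ⋃ p : Fin 4, ⋃ q : Fin 4, ⋃ (_ : p ≠ q),
      ({z : Fin 4 → E4 | z p 0 = z q 0} ∩ {z : Fin 4 → E4 | z p 1 = z q 1}) := by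
  ext z
  simp only [planarDegenerateSet, IsPlanarDegenerate, Set.mem_setOf_eq, Set.mem_iUnion, Set.mem_inter_iff,
    exists_prop, ne_eq]

/-- Each coordinate functional `z ↦ z p j` is continuous. -/
theorem continuous_coord (p : Fin 4) (j : Fin 4) : Continuous fun z : Fin 4 → E4 => z p j :=
  (EuclideanSpace.proj j).continuous.comp (continuous_apply p)

/-- The planar-degenerate set is closed. -/
theorem isClosed_planarDegenerateSet : IsClosed planarDegenerateSet := by
  rw [planarDegenerateSet_eq]
  refine isClosed_iUnion_of_finite fun p => isClosed_iUnion_of_finite fun q =>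
    isClosed_iUnion_of_finite fun _ => ?_
  exact (isClosed_eq (continuous_coord p 0) (continuous_coord q 0)).inter
    (isClosed_eq (continuous_coord p 1) (continuous_coord q 1))

/-- The linear functional `z ↦ z_p⁰ − z_q⁰` on `(ℝ⁴)⁴`. -/
def timeDiff (p q : Fin 4) : (Fin 4 → E4) →L[ℝ] ℝ :=
  (EuclideanSpace.proj (0 : Fin 4)).comp (ContinuousLinearMap.proj p) -
    (EuclideanSpace.proj (0 : Fin 4)).comp (ContinuousLinearMap.proj q)

/-- Unfolding `timeDiff`. -/
theorem timeDiff_apply (p q : Fin 4) (z : Fin 4 → E4) : timeDiff p q z = z p 0 - z q 0 := rfl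

/-- **An equal-time hyperplane `{z_p⁰ = z_q⁰}`, `p ≠ q`, is Lebesgue-null** (a proper linear subspace). [folklore] -/
theorem volume_eqTime_zero (p q : Fin 4) (hpq : p ≠ q) : volume {z : Fin 4 → E4 | z p 0 = z q 0} = 0 := by
  have hker : {z : Fin 4 → E4 | z p 0 = z q 0} =
      (LinearMap.ker (timeDiff p q : (Fin 4 → E4) →ₗ[ℝ] ℝ) : Set (Fin 4 → E4)) := by
    ext z
    simp only [Set.mem_setOf_eq, SetLike.mem_coe, LinearMap.mem_ker, ContinuousLinearMap.coe_coe,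
      timeDiff_apply, sub_eq_zero]
  have hne : LinearMap.ker (timeDiff p q : (Fin 4 → E4) →ₗ[ℝ] ℝ) ≠ ⊤ := by
    intro htop
    have hz : (Pi.single p (EuclideanSpace.single (0 : Fin 4) (1 : ℝ)) : Fin 4 → E4) ∈
        LinearMap.ker (timeDiff p q : (Fin 4 → E4) →ₗ[ℝ] ℝ) := by
      rw [htop]; trivial
    rw [LinearMap.mem_ker, ContinuousLinearMap.coe_coe, timeDiff_apply] at hz
    simp [hpq.symm] at hz
  rw [hker]
  exact Measure.addHaar_submodule volume _ hne

/-- **The planar-degenerate set is Lebesgue-null.** [folklore] -/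
theorem volume_planarDegenerateSet : volume planarDegenerateSet = 0 := by
  rw [planarDegenerateSet_eq]
  refine measure_iUnion_null fun p => measure_iUnion_null fun q => measure_iUnion_null fun hpq => ?_
  exact measure_mono_null Set.inter_subset_left (volume_eqTime_zero p q hpq)

/-- Coincident configurations are planar-degenerate. -/
theorem coincidenceLocus_subset_planarDegenerateSet : coincidenceLocus 4 E4 ⊆ planarDegenerateSet := by
  rintro z ⟨i, j, hij, h⟩
  exact ⟨i, j, hij, by rw [h], by rw [h]⟩

/-! ### Junk is not `NPointRegular` -/

/-- A Schwartz function supported off the planar-degenerate set is off-diagonal and killed by `J`. -/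
theorem J_eq_zero_of_tsupport_subset (G : 𝓢((Fin 4 → E4), ℂ))
    (hG : tsupport (G : (Fin 4 → E4) → ℂ) ⊆ planarDegenerateSetᶜ) : IsOffDiagonal G ∧ J G = 0 := by
  refine ⟨IsOffDiagonal.of_tsupport_subset
    (hG.trans (Set.compl_subset_compl.2 coincidenceLocus_subset_planarDegenerateSet)), ?_⟩
  exact J_eq_zero_of_planar_generic G fun z hz => image_eq_zero_of_notMem_tsupport fun hz' => hG hz' hz

/-- **The junk family is not `NPointRegular`**: no function represents `𝔖₄ = J` on `⁰𝒮`. Any representing `W₄`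
integrates to zero against every smooth compactly supported test function supported in the open complement `U` of the
planar-degenerate set (such functions are off-diagonal and killed by `J`, file VIII), is locally integrable on `U`
(test against an off-diagonal bump `≡ 1` near each point), hence vanishes a.e. on `U` (du Bois-Reymond) and so a.e.
(`U` is co-null) — contradicting `Re J F₀ > 0` (file IV). [folklore] -/
theorem not_nPointRegular_junk : ¬ NPointRegular junk := by
  intro h
  obtain ⟨W, hW⟩ := h 4
  set U : Set (Fin 4 → E4) := planarDegenerateSetᶜ with hUdef
  have hUo : IsOpen U := isClosed_planarDegenerateSet.isOpen_compl
  -- (1) test functions supported in `U` are killed by `∫ W ·`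
  have hkill : ∀ G : 𝓢((Fin 4 → E4), ℂ), tsupport (G : (Fin 4 → E4) → ℂ) ⊆ U →
      Integrable (fun x : Fin 4 → E4 => W x * G x) ∧ ∫ x : Fin 4 → E4, W x * G x = 0 := by
    intro G hG
    obtain ⟨hoff, hJ⟩ := J_eq_zero_of_tsupport_subset G hG
    refine ⟨(hW G hoff).1, ?_⟩
    rw [← (hW G hoff).2]
    exact hJ
  -- (2) `W` is locally integrable on `U`
  have hloc : LocallyIntegrableOn W U volume := by
    intro x hx
    obtain ⟨ε, hε, hball⟩ := Metric.isOpen_iff.1 hUo x hx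
    let φ : ContDiffBump x := ⟨ε / 4, ε / 2, by positivity, by linarith⟩
    have hφs : HasCompactSupport fun y => ((φ y : ℝ) : ℂ) := φ.hasCompactSupport.comp_left Complex.ofReal_zero
    have hφd : ContDiff ℝ ((⊤ : ℕ∞) : WithTop ℕ∞) fun y => ((φ y : ℝ) : ℂ) :=
      Complex.ofRealCLM.contDiff.comp φ.contDiff
    set G : 𝓢((Fin 4 → E4), ℂ) := hφs.toSchwartzMap hφd with hGdef
    have hG_apply : ∀ y, G y = ((φ y : ℝ) : ℂ) := fun y => rfl
    have hGsupp : tsupport (G : (Fin 4 → E4) → ℂ) ⊆ U := by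
      intro y hy
      have hy2 : y ∈ tsupport ((fun r : ℝ => ((r : ℝ) : ℂ)) ∘ (φ : (Fin 4 → E4) → ℝ)) := hy
      have hy' : y ∈ tsupport (φ : (Fin 4 → E4) → ℝ) :=
        tsupport_comp_subset (g := fun r : ℝ => ((r : ℝ) : ℂ)) Complex.ofReal_zero _ hy2
      rw [φ.tsupport_eq] at hy'
      have hr : φ.rOut = ε / 2 := rfl
      rw [hr] at hy'
      exact hball (Metric.closedBall_subset_ball (by linarith) hy')
    have hint : Integrable (fun y : Fin 4 → E4 => W y * G y) := (hkill G hGsupp).1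
    refine ⟨Metric.ball x (ε / 4), mem_nhdsWithin_of_mem_nhds (Metric.ball_mem_nhds x (by positivity)), ?_⟩
    refine (hint.integrableOn (s := Metric.ball x (ε / 4))).congr_fun (fun y hy => ?_) measurableSet_ball
    have h1 : φ y = 1 := φ.one_of_mem_closedBall (Metric.ball_subset_closedBall hy)
    simp [hG_apply, h1]
  -- (3) `W = 0` a.e. on `U`
  have hae : ∀ᵐ x ∂(volume : Measure (Fin 4 → E4)), x ∈ U → W x = 0 := by
    refine hUo.ae_eq_zero_of_integral_contDiff_smul_eq_zero hloc fun g hg hgs hgU => ?_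
    have hcs : HasCompactSupport fun y => ((g y : ℝ) : ℂ) := hgs.comp_left Complex.ofReal_zero
    have hcd : ContDiff ℝ ((⊤ : ℕ∞) : WithTop ℕ∞) fun y => ((g y : ℝ) : ℂ) :=
      Complex.ofRealCLM.contDiff.comp hg
    set G : 𝓢((Fin 4 → E4), ℂ) := hcs.toSchwartzMap hcd with hGdef
    have hG_apply : ∀ y, G y = ((g y : ℝ) : ℂ) := fun y => rfl
    have hGsupp : tsupport (G : (Fin 4 → E4) → ℂ) ⊆ U := by
      intro y hy
      have hy2 : y ∈ tsupport ((fun r : ℝ => ((r : ℝ) : ℂ)) ∘ g) := hy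
      exact hgU (tsupport_comp_subset (g := fun r : ℝ => ((r : ℝ) : ℂ)) Complex.ofReal_zero _ hy2)
    have h0 := (hkill G hGsupp).2
    have heq : (fun y : Fin 4 → E4 => g y • W y) = fun y => W y * G y := by
      funext y
      rw [hG_apply, Complex.real_smul, mul_comm]
    rw [heq]
    exact h0
  -- (4) `U` is co-null, so `W = 0` a.e.
  have hfull : ∀ᵐ x ∂(volume : Measure (Fin 4 → E4)), x ∈ U := by
    rw [hUdef]
    exact compl_mem_ae_iff.2 volume_planarDegenerateSet
  have hW0 : ∀ᵐ x ∂(volume : Measure (Fin 4 → E4)), W x = 0 := by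
    filter_upwards [hae, hfull] with x h1 h2 using h1 h2
  -- (5) contradiction with `Re J F₀ > 0`
  have hJ : J F₀ = ∫ x : Fin 4 → E4, W x * F₀ x := (hW F₀ F₀_isOffDiagonal).2
  have hint0 : ∫ x : Fin 4 → E4, W x * F₀ x = 0 := by
    have hz : (fun x : Fin 4 → E4 => W x * F₀ x) =ᵐ[volume] fun _ => (0 : ℂ) := by
      filter_upwards [hW0] with x hx
      simp [hx]
    rw [integral_congr_ae hz, integral_zero]
  have hpos := J_F₀_re_pos
  rw [hJ, hint0, Complex.zero_re] at hpos
  exact lt_irrefl _ hpos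

end Summit.QuantumFields.YangMills.Theorems.NPointIsotropy.Negative

end
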